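import Summits.AtomisticToContinuum.BoseEinsteinCondensation.Theorems.BECStronglyRayleighLatticeToPeriodicBridgeMuffinTinDeepWellLimit
import Literature.MathematicalPhysics.QuantumManyBody.CondensateOccupationStability
import Mathlib.Analysis.SpecialFunctions.Integrals.Basic
import Mathlib.MeasureTheory.Integral.Pi
import HarnessLib

/-!
# Route `BECStronglyRayleigh`, crux `LatticeToPeriodicBridge` (stmt-AtomisticToContinuum-9674),
# line `muffin-tin-reward-supermodularity` — S2' decomposition, file 1/5: the explicit deep-wall limit profiles

Worker decomposition of the registered open stub `Sig.stub_deepWellCondensateLimit := DeepWellCondensateLimit`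
(`…MuffinTinDeepWellLimit.lean`; corner audit: TRUE on paper, no false corner, not provable now — no Schrödinger
spectral theory in Mathlib). The analytic debt is split into TWO named statements, (P1) `FreeDeepBandLimit`
(free / one-body square-barrier deep-band `L²`-limit; in print, not in Mathlib) and (P2) `HardCoreDeepWellLimit`
(`N`-boson `M³`-well strong-confinement `L²`-limit; NOT in print beyond two wells / one body), both phrased as
`L²([0,L)^{3N})`-convergence modulo a phase of near-minimisers of `E_v + λ⟨W⟩` to EXPLICIT limit profiles defined
here over tree vocabulary; everything that is not spectral theory (the readout (P3) `ProfileReadout` of the profiles'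
norms and constant-mode occupations, the lattice bound `cohSum ≤ M³N`, and the glue
(P1) ∧ (P2) ⇒ `Sig.stub_deepWellCondensateLimit`) is PROVED in files 2–5
(`…DeepWellOneBody`, `…DeepWellFreeReadout`, `…DeepWellReadout`, `…DeepWellDecomposition`).

This file (definitions only, plus Fubini on `ℝ³`):
* `DeepWell.wellSine ℓ s` — Dirichlet sine `√(2/ℓ) sin(π(t-s)/ℓ)` of `[s, s+ℓ]` extended by zero (clamped argument,
  manifestly continuous); `DeepWell.wellOff` — well offsets `s_j = jb + wb` (`b = L/M`, walls `[jb, jb+wb)` as in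
  `wallCount`); `DeepWell.wellMode` — well ground state `u_x`, `x ∈ (ℤ/M)³`, a cube of side `ℓ = (1-w)b`;
  `DeepWell.blochMode1`, `DeepWell.blochMode` — the deep-wall limit `M^{-3/2} Σ_x u_x` of the one-body Bloch ground
  state; `DeepWell.freeProfile = blochMode^{⊗N}`; `DeepWell.basisFun f = ∏ᵢ u_{f i}(xᵢ)`;
  `DeepWell.hardCoreProfile ψ = (N!)^{-1/2} Σ_f ψ(1_{im f}) ∏ᵢ u_{f i}(xᵢ)` (`= Σ_{|S|=N} ψ(1_S) u_S` on the sector);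
  `DeepWell.wellOverlap = ∫u_x`; `DeepWell.consAmp` — the contracted amplitude of `a(φ₀)`;
* the statements (P1) `FreeDeepBandLimit`, (P2) `HardCoreDeepWellLimit` (analytic debts, deliberately untagged) and
  (P3) `ProfileReadout` (proved in file 4 as `profileReadout`);
* `DeepWell.integral_space_prod` (Fubini for coordinate products on `ℝ³`) and the registered sub-goal
  `deepWellProfiles_integralCoordProd`.

References (for the debts, not used in proofs): T. Kato, *Perturbation Theory for Linear Operators*, VIII §3;
B. Simon, J. Funct. Anal. 28 (1978) 377; M. Reed, B. Simon, *Methods of Modern Mathematical Physics IV*, §XIII.16;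
N. Rougerie, D. Spehner, Comm. Math. Phys. 361 (2018) 737; B. Helffer, J. Sjöstrand, Comm. PDE 9 (1984) 337;
M. Aizenman, E. H. Lieb, R. Seiringer, J. P. Solovej, J. Yngvason, Phys. Rev. A 70 (2004) 023612;
LSSY 2005 App. A (A.11)–(A.14) (`a(φ)`, `n₀`).
-/

noncomputable section

namespace Summit.AtomisticToContinuum.BoseEinsteinCondensation.Cruxes.LatticeToPeriodicBridge.MuffinTinRewardSupermodularity

open MeasureTheory Filter Set
open scoped ENNReal NNReal BigOperators Topology ComplexConjugate
open Literature.MathematicalPhysics.QuantumManyBody.BoseGas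
open Literature.MathematicalPhysics.QuantumLattice
open Literature.Probability.LatticeModels (TorusSite)
open Summit.AtomisticToContinuum.BoseEinsteinCondensation.Theses
open Summit.AtomisticToContinuum.BoseEinsteinCondensation.Theses.BECStronglyRayleigh
open Summit.AtomisticToContinuum.BoseEinsteinCondensation.Theorems

namespace DeepWell

/-! ## One-body building blocks -/

/-- The Dirichlet ground state `√(2/ℓ) sin(π(t-s)/ℓ)` of the interval `[s, s+ℓ]`, extended by zero (written with the clamp `max 0 (min 1 ·)`, manifestly continuous). [folklore] -/
def wellSine (ℓ s t : ℝ) : ℝ :=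
  Real.sqrt (2 / ℓ) * Real.sin (Real.pi * max 0 (min 1 ((t - s) / ℓ)))

/-- Fubini for coordinate products on `ℝ³`: `∫ ∏ₖ gₖ(yₖ) dy = ∏ₖ ∫ gₖ`. [folklore] -/
theorem integral_space_prod (g : Fin 3 → ℝ → ℝ) : ∫ y : Space, ∏ k, g k (y k) = ∏ k, ∫ t, g k t := by
  have h := (PiLp.volume_preserving_toLp (Fin 3)).integral_comp
    (MeasurableEquiv.toLp 2 (Fin 3 → ℝ)).measurableEmbedding (fun y : Space => ∏ k, g k (y k))
  rw [← h]
  exact integral_fintype_prod_volume_eq_prod (𝕜 := ℝ) g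

/-- The offset `s_j = j b + w b` of the well of period `j ∈ ℤ/M` (`b = L/M`; the wall slab `[jb, jb + wb)` sits at
the start of each period, as in `wallCount`). [folklore] -/
def wellOff (M : ℕ) (L w : ℝ) (j : ZMod M) : ℝ := (j.val : ℝ) * (L / M) + w * (L / M)

/-- The Dirichlet ground state `u_x(y) = ∏ₖ u₁(yₖ; xₖ)` of the well of site `x ∈ (ℤ/M)³` (a cube of side `ℓ = (1-w)L/M`). [folklore] -/
def wellMode (M : ℕ) (L w : ℝ) (x : TorusSite 3 M) (y : Space) : ℝ :=
  ∏ k : Fin 3, wellSine ((1 - w) * (L / M)) (wellOff M L w (x k)) (y k)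

/-- The unnormalised 1D comb `Σ_j u₁(·; j)` of well ground states (one per period). [folklore] -/
def blochMode1 (M : ℕ) [NeZero M] (L w : ℝ) (t : ℝ) : ℝ :=
  ∑ j : ZMod M, wellSine ((1 - w) * (L / M)) (wellOff M L w j) t

/-- The deep-wall limit of the one-body Bloch ground state of `-Δ + λW` on the torus: `M^{-3/2} Σ_x u_x = M^{-3/2} ∏ₖ (Σ_j u₁(yₖ; j))` (normalised symmetric combination of the well ground states). [folklore] -/
def blochMode (M : ℕ) [NeZero M] (L w : ℝ) (y : Space) : ℝ :=
  (Real.sqrt ((M : ℝ) ^ 3))⁻¹ * ∏ k : Fin 3, blochMode1 M L w (y k)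

/-! ## `N`-body profiles -/

/-- The deep-wall limit profile of the FREE `N`-boson ground state, `(blochMode)^{⊗N}`. [folklore] -/
def freeProfile (M : ℕ) [NeZero M] (L w : ℝ) (N : ℕ) (X : Config N) : ℂ :=
  ((∏ i : Fin N, blochMode M L w (X i) : ℝ) : ℂ)

/-- Hard-core well-occupation basis function `P_f(X) = ∏ᵢ u_{f i}(xᵢ)` for an assignment `f : Fin N → sites`
(for non-injective `f` two particles share a well; such terms drop out on the `N`-sector). [folklore] -/
def basisFun {N : ℕ} (M : ℕ) (L w : ℝ) (f : Fin N → TorusSite 3 M) (X : Config N) : ℝ :=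
  ∏ i, wellMode M L w (f i) (X i)

/-- The deep-wall limit profile of the INTERACTING `N`-boson ground state dressed by a lattice vector `ψ`:
`Φ_ψ = (N!)^{-1/2} Σ_{f : Fin N → sites} ψ(1_{im f}) ∏ᵢ u_{f i}(xᵢ)`. For `ψ` supported on `N`-sets (the sector
`S³ = N - M³/2`) only injective `f` contribute and `Φ_ψ = Σ_{|S|=N} ψ(1_S) u_S` with `u_S` the normalised
symmetrised product of the well ground states of the sites of `S` (hard-core well occupations). [folklore] -/
def hardCoreProfile (M : ℕ) [NeZero M] (L w : ℝ) (N : ℕ) (ψ : TensorIndex (TorusSite 3 M) 2 → ℂ)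
    (X : Config N) : ℂ :=
  ((Real.sqrt (N.factorial : ℝ))⁻¹ : ℂ) *
    ∑ f : Fin N → TorusSite 3 M, ψ (occInd (Finset.univ.image f)) * (basisFun M L w f X : ℂ)

/-- The one-body overlap `W = ∫ u_x` (independent of the site). [folklore] -/
def wellOverlap (M : ℕ) (L w : ℝ) : ℝ :=
  (Real.sqrt (2 / ((1 - w) * (L / M))) * (2 * ((1 - w) * (L / M)) / Real.pi)) ^ 3

/-- The contracted amplitude `d_g = Σ_a ψ(1_{im g ∪ {a}})`. [folklore] -/
def consAmp {M : ℕ} [NeZero M] {n : ℕ} (ψ : TensorIndex (TorusSite 3 M) 2 → ℂ) (g : Fin n → TorusSite 3 M) : ℂ :=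
  ∑ a : TorusSite 3 M, ψ (occInd (insert a (Finset.univ.image g)))

end DeepWell

open DeepWell

/-! ## The two analytic debts (P1), (P2) and the readout statement (P3) -/

/-- **(P1) Free deep-band limit (one-body square-barrier Kronig–Penney, tensorised).** For a measurable
profile `v` vanishing a.e. on `(0,∞)` (so `Σ v^per |Ψ|²` integrates to `0` for every trial state: the FREE
problem), `w ∈ (0,1)`, `M ≥ 1`, `L > 0`, `N ≥ 1`: for every `η > 0`, eventually in the wall height `λ`, every
window `δ > 0` contains a `δ`-near-minimiser of `Ψ ↦ E_v[Ψ] + λ⟨W⟩_Ψ` within `η` in `L²([0,L)^{3N})` of a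
phase times `freeProfile = (M^{-3/2} Σ_x u_x)^{⊗N}`. (The `N`-boson free ground state is `φ_λ^{⊗N}`, `φ_λ`
the simple, `b`-periodic, positive ground state of `-Δ + λW` on the torus; `φ_λ → M^{-3/2}Σ_x u_x` in `L²` by
monotone convergence of the forms `∫|∇φ|² + λ∫_W|φ|²` to the Dirichlet form of the wells and compactness.)
In print: Kato VIII §3 / Simon, J. Funct. Anal. 28 (1978) 377 (monotone form limits); Reed–Simon IV §XIII.16
(Kronig–Penney); not in Mathlib. Analytic debt of S2' — deliberately untagged. -/
def FreeDeepBandLimit : Prop :=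
  ∀ (v : ℝ → ℝ≥0∞), Measurable v → (∀ᵐ r : ℝ, 0 < r → v r = 0) →
    ∀ w : ℝ, 0 < w → w < 1 →
      ∀ (M : ℕ) [NeZero M], ∀ L : ℝ, 0 < L →
        ∀ N : ℕ, 1 ≤ N →
          ∀ η : ℝ, 0 < η → ∀ᶠ lam : ℝ in atTop, ∀ δ : ℝ≥0∞, 0 < δ →
            ∃ Ψ : PeriodicTrialState N L,
              twoCouplingFunctional v M w lam 0 Ψ ≤ twoCouplingEnergy v N L M w lam 0 + δ ∧
              ∃ θ : ℝ, ∫⁻ X in cellN N L,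
                  (‖Ψ.ψ X - Complex.exp (θ * Complex.I) * freeProfile M L w N X‖₊ : ℝ≥0∞) ^ 2 ≤
                ENNReal.ofReal η

/-- **(P2) Hard-core deep-well limit (`N`-boson strong-confinement / tight-binding reduction; NOT in
print).** Same data as `DeepWellCondensateLimit` plus `v ≠ 0` on a positive-measure subset of `(0,∞)`: for
every `η > 0`, eventually in `λ`, every window `δ > 0` contains a `δ`-near-minimiser within `η` in
`L²([0,L)^{3N})` of a phase times `hardCoreProfile ψ = Σ_{|S|=N} ψ(1_S) u_S`, `ψ` any normalised sector-`N`
ground vector of `xyTorus 3 M 1` (unique up to phase, `SectorGroundStatePerron`). Why true: `R₀ < ℓ` gives an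
in-well pair cost `U > 0` fixed as `λ → ∞` while the tunnelling `t_λ → 0`; `2R₀ < wb` makes inter-well
interaction `o(t_λ)`; first-order degenerate perturbation theory on the `C(M³,N)` hard-core well occupations
dressed by the lowest Bloch band gives `N ε̄(λ) + t_λ (4·xyTorus 3 M 1 + o(1))` in the `N`-sector, whose
ground vector is simple. Nearest in print: Rougerie–Spehner, CMP 361 (2018) 737 (two wells); Helffer–Sjöstrand,
Comm. PDE 9 (1984) 337 (one body); ALSSY, Phys. Rev. A 70 (2004) 023612 (lattice side only). Analytic debt of
S2' — deliberately untagged. -/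
def HardCoreDeepWellLimit : Prop :=
  ∀ (v : ℝ → ℝ≥0∞) (R₀ : ℝ), Measurable v → 0 ≤ R₀ → (∀ r, R₀ < r → v r = 0) →
    (¬ ∀ᵐ r : ℝ, 0 < r → v r = 0) →
    ∀ w : ℝ, 0 < w → w < 1 →
      ∀ (M : ℕ) [NeZero M], 2 ≤ M → ∀ L : ℝ, 0 < L →
        2 * R₀ < w * (L / M) → R₀ < (1 - w) * (L / M) →
        ∀ N : ℕ, 1 ≤ N → N ≤ M ^ 3 →
          ∀ ψ : TensorIndex (TorusSite 3 M) 2 → ℂ, IsSectorGround M N ψ →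
            ∀ η : ℝ, 0 < η → ∀ᶠ lam : ℝ in atTop, ∀ δ : ℝ≥0∞, 0 < δ →
              ∃ Ψ : PeriodicTrialState N L,
                twoCouplingFunctional v M w lam 0 Ψ ≤ twoCouplingEnergy v N L M w lam 0 + δ ∧
                ∃ θ : ℝ, ∫⁻ X in cellN N L,
                    (‖Ψ.ψ X - Complex.exp (θ * Complex.I) * hardCoreProfile M L w N ψ X‖₊ : ℝ≥0∞) ^ 2 ≤
                  ENNReal.ofReal η

/-- **(P3) Profile readout** (statement; PROVED in file 4 `…DeepWellReadout` as `profileReadout`). For `L > 0`, `w ∈ (0,1)`, `N ≥ 1`: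
`freeProfile` is normalised on the cell with `n₀ = z_w N`, and for a normalised vector `ψ` of the sector of
`N` up spins `hardCoreProfile ψ` is normalised with `n₀ = z_w cohSum(ψ)/M³` (`z_w = deepShare w`). Statement of the line's decomposition (its witness `profileReadout` lands in file 4) — deliberately untagged. -/
def ProfileReadout : Prop :=
  ∀ (M : ℕ) [NeZero M] (L w : ℝ), 0 < L → 0 < w → w < 1 → ∀ N : ℕ, 1 ≤ N →
    (∫⁻ X in cellN N L, (‖freeProfile M L w N X‖₊ : ℝ≥0∞) ^ 2 = 1 ∧
      condensateOccupation N L (freeProfile M L w N) = ENNReal.ofReal (deepShare w * N)) ∧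
    ∀ ψ : TensorIndex (TorusSite 3 M) 2 → ℂ,
      ψ ∈ spinZSector 1 ((N : ℝ) - (M : ℝ) ^ 3 / 2) → ∑ σ, ‖ψ σ‖ ^ 2 = 1 →
        ∫⁻ X in cellN N L, (‖hardCoreProfile M L w N ψ X‖₊ : ℝ≥0∞) ^ 2 = 1 ∧
        condensateOccupation N L (hardCoreProfile M L w N ψ) =
          ENNReal.ofReal (deepShare w / (M : ℝ) ^ 3 * cohSum ψ N)

/-! ## The registered sub-goal of this file -/

/-- **Registered sub-goal `deepWellProfiles_integralCoordProd`** (S2' decomposition, file 1/5): Fubini for coordinate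
products on `ℝ³`, `∫ ∏ₖ gₖ(yₖ) dy = ∏ₖ ∫ gₖ` (`DeepWell.integral_space_prod` with global names). [folklore] -/
theorem deepWellProfiles_integralCoordProd :
    ∀ g : Fin 3 → ℝ → ℝ, MeasureTheory.integral MeasureTheory.volume (fun y : EuclideanSpace ℝ (Fin 3) => ∏ k : Fin 3, g k (y k)) = ∏ k : Fin 3, MeasureTheory.integral MeasureTheory.volume (g k) :=
  fun g => DeepWell.integral_space_prod g

end Summit.AtomisticToContinuum.BoseEinsteinCondensation.Cruxes.LatticeToPeriodicBridge.MuffinTinRewardSupermodularity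

end
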